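import Literature.Geometry.Lorentzian.SchwarzschildKerrSchildComponents
import Literature.Geometry.Lorentzian.KerrDataSchwarzschildExtrinsic
import HarnessLib

/-!
# Route PhotonSphereChannels · crux `ChannelsResolveTameDevelopmentsR` (K2R-T2, stmt-FinalStateConjecture-17430) —
# the SCHWARZSCHILD END, IV-c: the clock-adapted orthonormalising frame of a radial form at a point
# (`A = [[1, 0], [v, L]]`, `L = 1 + (c − 1) n nᵀ`, `v = −λ n`), its inverse, its norm, and the pull-back identity
# `Aᵀ (η + S dt*² + μ(dt*⊗ν + ν⊗dt*) + κ ν⊗ν) A = η + (κ/(1+κ)) dt*²`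

The tame balls of `EndDatum.IsTameEnd` must satisfy `clock ∘ Ψ = x⁰ + clock q` EXACTLY, so in clock coordinates the
linear part `A` of the chart at the centre has time row `(1, 0, 0, 0)`: `A u = u⁰ ∂_{t*} + (u⃗ + P(u) n, 0)` — only the
spatial legs and the tilt of the time leg are free. For the radial form `η + S dt*² + μ(dt*⊗ν + ν⊗dt*) + κ ν⊗ν`,
`ν = ⟪n, ·⃗⟫`, `‖n‖ = 1` (file IV-b: the Schwarzschild metric read through a radial clock at a point of the ray
`ℝ₊ n`, `S = 2M/r`), the optimal such frame scales the radial leg by `c = (1 + κ)^{-1/2}` and tilts the time leg by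
`v = −λ n`, `λ = μ/(1 + κ)`; it pulls the form back to `η + (κ/(1 + κ)) dt*²` EXACTLY (the residue `κ/(1+κ) = 1 − α²`,
`α` the lapse of the clock, is forced: no frame with time row `(1,0,0,0)` does better), and `κ = 0` at the
Painlevé–Gullstrand rate. Contents (all proved, no definitions; the frame is an explicit continuous linear map and the
statements quantify over its closed form):

* `Schw.exists_frameEquiv` — the frame as a continuous linear AUTOMORPHISM of `E4` (explicit inverse), for `c ≠ 0`;
* `Schw.frame_apply_zero`, `Schw.spatial_frame`, `Schw.norm_frame_le` — time row, spatial part, `‖A u‖ ≤ 3‖u‖`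
  (for `0 < c ≤ 1`, `0 ≤ λ ≤ 1`);
* `Schw.frame_pullback` — the pull-back identity, from the relations `c²(1+κ) = 1`, `λ(1+κ) = μ`, `μ² + (1 − S)κ = S`;
* `Schw.clockRate_relations` — for `S = s² ∈ [0, 1)` and a rate `0 ≤ p ≤ s/(1+s)`: `μ = S + p(1−S)`,
  `κ = S(1−p)² − p²` satisfy `0 ≤ κ ≤ S`, `0 ≤ μ ≤ 1`, `μ² + (1−S)κ = S`, and `κ = 0` at `p = s/(1+s)`.

References: K. Martel, E. Poisson, Am. J. Phys. 69 (2001) 476, §II [MartelPoisson2001]; M. T. Anderson (2004),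
Def. 1.1 (the harmonic/adapted-ball formalism the interface paraphrases) [Anderson2004].
-/

noncomputable section
set_option linter.dupNamespace false -- `Summit.FinalStateConjecture.FinalStateConjecture.…` is the tree's layout

open TopologicalSpace Filter Topology Set Function
open scoped ContDiff Topology InnerProductSpace

namespace Summit.FinalStateConjecture.FinalStateConjecture.Theorems.TameHull.Schw

open Literature.Geometry.Lorentzian Schwarzschild

/-! ### Time/space bookkeeping on `E4` -/

/-- `u = u⁰ ∂_{t*} + (0, u⃗)`. [folklore] -/
theorem time_smul_add_ofTimeSpace_spatial (u : E4) :
    (u 0) • (E4.basisVector 0 : E4) + E4.ofTimeSpace 0 (E4.spatial u) = u := by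
  ext i
  refine Fin.cases ?_ (fun j ↦ ?_) i
  · simp [E4.ofTimeSpace_apply_zero]
  · simp [E4.ofTimeSpace_apply_succ, E4.spatial_apply, Fin.succ_ne_zero]

/-- Components of `t ∂_{t*} + (0, y)`: time `t`, space `y`. [folklore] -/
theorem components_time_smul_add_ofTimeSpace (t : ℝ) (y : E3) :
    (t • (E4.basisVector 0 : E4) + E4.ofTimeSpace 0 y) 0 = t ∧
      E4.spatial (t • (E4.basisVector 0 : E4) + E4.ofTimeSpace 0 y) = y := by
  have h : E4.spatial (E4.basisVector 0) = 0 := by ext i; simp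
  refine ⟨by simp [E4.ofTimeSpace_apply_zero], ?_⟩
  rw [map_add, map_smul, h, smul_zero, zero_add, E4.spatial_ofTimeSpace]

/-- `‖u‖² = (u⁰)² + ‖u⃗‖²`, hence `|u⁰| ≤ ‖u‖` and `‖u⃗‖ ≤ ‖u‖`. [folklore] -/
theorem norm_sq_eq_time_sq_add (u : E4) :
    ‖u‖ ^ 2 = (u 0) ^ 2 + ‖E4.spatial u‖ ^ 2 ∧ |u 0| ≤ ‖u‖ ∧ ‖E4.spatial u‖ ≤ ‖u‖ := by
  have h : ‖u‖ ^ 2 = (u 0) ^ 2 + ‖E4.spatial u‖ ^ 2 := by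
    rw [← real_inner_self_eq_norm_sq, Kerr.inner_eq_time_add_spatial, real_inner_self_eq_norm_sq]; ring
  refine ⟨h, ?_, ?_⟩
  · refine (pow_le_pow_iff_left₀ (abs_nonneg _) (norm_nonneg u) two_ne_zero).mp ?_
    rw [sq_abs]; nlinarith [sq_nonneg ‖E4.spatial u‖]
  · refine (pow_le_pow_iff_left₀ (norm_nonneg _) (norm_nonneg u) two_ne_zero).mp ?_
    nlinarith [sq_nonneg (u 0)]

/-! ### The frame -/

section Frame

variable (n : E3) (cst lam : ℝ)

/-- **The clock-adapted frame as a continuous linear automorphism of `E4`.** For a unit vector `n`, `c ≠ 0` and any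
`λ`, the map `A u = u⁰ ∂_{t*} + (0, u⃗ + ((c − 1)⟪n, u⃗⟫ − λ u⁰) n)` (radial leg scaled by `c`, time leg tilted by
`−λ n`, time row `(1, 0, 0, 0)`) is a continuous linear equivalence, with inverse
`z ↦ z⁰ ∂_{t*} + (0, z⃗ + ((c⁻¹ − 1)⟪n, z⃗⟫ + λ c⁻¹ z⁰) n)`. [folklore] -/
theorem exists_frameEquiv (hn : ‖n‖ = 1) (hc : cst ≠ 0) :
    ∃ A : E4 ≃L[ℝ] E4, ∀ u : E4, A u = (u 0) • (E4.basisVector 0 : E4) +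
      E4.ofTimeSpace 0 (E4.spatial u + ((cst - 1) * ⟪n, E4.spatial u⟫_ℝ - lam * u 0) • n) := by
  -- forward and backward maps as continuous linear maps
  set Asp : E4 →L[ℝ] E3 := E4.spatial +
    ((cst - 1) • (innerSL ℝ n).comp E4.spatial - lam • E4.dx 0).smulRight n with hAsp
  set A : E4 →L[ℝ] E4 := (E4.dx 0).smulRight (E4.basisVector 0 : E4) + Kerr.sliceEmbedCLM.comp Asp with hA
  set Bsp : E4 →L[ℝ] E3 := E4.spatial +
    ((cst⁻¹ - 1) • (innerSL ℝ n).comp E4.spatial + (lam * cst⁻¹) • E4.dx 0).smulRight n with hBsp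
  set B : E4 →L[ℝ] E4 := (E4.dx 0).smulRight (E4.basisVector 0 : E4) + Kerr.sliceEmbedCLM.comp Bsp with hB
  have hAu : ∀ u : E4, A u = (u 0) • (E4.basisVector 0 : E4) +
      E4.ofTimeSpace 0 (E4.spatial u + ((cst - 1) * ⟪n, E4.spatial u⟫_ℝ - lam * u 0) • n) := by
    intro u
    simp only [hA, hAsp, _root_.add_apply, ContinuousLinearMap.smulRight_apply, ContinuousLinearMap.comp_apply,
      Kerr.sliceEmbedCLM_apply, _root_.sub_apply, FunLike.coe_smul, Pi.smul_apply, innerSL_apply_apply,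
      smul_eq_mul]
    rfl
  have hBu : ∀ z : E4, B z = (z 0) • (E4.basisVector 0 : E4) +
      E4.ofTimeSpace 0 (E4.spatial z + ((cst⁻¹ - 1) * ⟪n, E4.spatial z⟫_ℝ + lam * cst⁻¹ * z 0) • n) := by
    intro z
    simp only [hB, hBsp, _root_.add_apply, ContinuousLinearMap.smulRight_apply, ContinuousLinearMap.comp_apply,
      Kerr.sliceEmbedCLM_apply, FunLike.coe_smul, Pi.smul_apply, innerSL_apply_apply, smul_eq_mul]
    rfl
  have hnn : ⟪n, n⟫_ℝ = 1 := by rw [real_inner_self_eq_norm_sq, hn, one_pow]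
  have hBA : ∀ u, B (A u) = u := by
    intro u
    rw [hBu, hAu]
    obtain ⟨h0, hsp⟩ := components_time_smul_add_ofTimeSpace (u 0)
      (E4.spatial u + ((cst - 1) * ⟪n, E4.spatial u⟫_ℝ - lam * u 0) • n)
    rw [h0, hsp, inner_add_right, inner_smul_right, hnn, mul_one]
    have hPQ : ((cst - 1) * ⟪n, E4.spatial u⟫_ℝ - lam * u 0) +
        ((cst⁻¹ - 1) * (⟪n, E4.spatial u⟫_ℝ + ((cst - 1) * ⟪n, E4.spatial u⟫_ℝ - lam * u 0)) +
          lam * cst⁻¹ * u 0) = 0 := by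
      field_simp
      ring
    rw [add_assoc, ← add_smul, hPQ, zero_smul, add_zero]
    exact time_smul_add_ofTimeSpace_spatial u
  have hAB : ∀ z, A (B z) = z := by
    intro z
    rw [hAu, hBu]
    obtain ⟨h0, hsp⟩ := components_time_smul_add_ofTimeSpace (z 0)
      (E4.spatial z + ((cst⁻¹ - 1) * ⟪n, E4.spatial z⟫_ℝ + lam * cst⁻¹ * z 0) • n)
    rw [h0, hsp, inner_add_right, inner_smul_right, hnn, mul_one]
    have hPQ : ((cst⁻¹ - 1) * ⟪n, E4.spatial z⟫_ℝ + lam * cst⁻¹ * z 0) +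
        ((cst - 1) * (⟪n, E4.spatial z⟫_ℝ + ((cst⁻¹ - 1) * ⟪n, E4.spatial z⟫_ℝ + lam * cst⁻¹ * z 0)) -
          lam * z 0) = 0 := by
      field_simp
      ring
    rw [add_assoc, ← add_smul, hPQ, zero_smul, add_zero]
    exact time_smul_add_ofTimeSpace_spatial z
  exact ⟨ContinuousLinearEquiv.equivOfInverse A B hBA hAB, hAu⟩

/-- Time row and spatial part of the frame: `(A u)⁰ = u⁰`, `(A u)⃗ = u⃗ + ((c − 1)⟪n, u⃗⟫ − λ u⁰) n`. [folklore] -/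
theorem frame_components (u : E4) :
    ((u 0) • (E4.basisVector 0 : E4) +
        E4.ofTimeSpace 0 (E4.spatial u + ((cst - 1) * ⟪n, E4.spatial u⟫_ℝ - lam * u 0) • n)) 0 = u 0 ∧
      E4.spatial ((u 0) • (E4.basisVector 0 : E4) +
        E4.ofTimeSpace 0 (E4.spatial u + ((cst - 1) * ⟪n, E4.spatial u⟫_ℝ - lam * u 0) • n)) =
        E4.spatial u + ((cst - 1) * ⟪n, E4.spatial u⟫_ℝ - lam * u 0) • n :=
  components_time_smul_add_ofTimeSpace _ _

/-- **The frame is uniformly bounded**: `‖A u‖ ≤ 3‖u‖` when `‖n‖ = 1`, `0 < c ≤ 1`, `0 ≤ λ ≤ 1`. [folklore] -/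
theorem norm_frame_le (hn : ‖n‖ = 1) (hc0 : 0 < cst) (hc1 : cst ≤ 1) (hl0 : 0 ≤ lam) (hl1 : lam ≤ 1) (u : E4) :
    ‖(u 0) • (E4.basisVector 0 : E4) +
        E4.ofTimeSpace 0 (E4.spatial u + ((cst - 1) * ⟪n, E4.spatial u⟫_ℝ - lam * u 0) • n)‖ ≤ 3 * ‖u‖ := by
  set y : E4 := (u 0) • (E4.basisVector 0 : E4) +
    E4.ofTimeSpace 0 (E4.spatial u + ((cst - 1) * ⟪n, E4.spatial u⟫_ℝ - lam * u 0) • n) with hy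
  obtain ⟨hy0, hysp⟩ := components_time_smul_add_ofTimeSpace (u 0)
    (E4.spatial u + ((cst - 1) * ⟪n, E4.spatial u⟫_ℝ - lam * u 0) • n)
  obtain ⟨hsq, habs, hspn⟩ := norm_sq_eq_time_sq_add u
  obtain ⟨hysq, -, -⟩ := norm_sq_eq_time_sq_add y
  rw [← hy] at hy0 hysp
  -- the correction `P(u) n` has norm `≤ ‖u⃗‖ + |u⁰| ≤ 2‖u‖`
  have hinner : |⟪n, E4.spatial u⟫_ℝ| ≤ ‖E4.spatial u‖ := by
    have := abs_real_inner_le_norm n (E4.spatial u); rwa [hn, one_mul] at this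
  have hP : |(cst - 1) * ⟪n, E4.spatial u⟫_ℝ - lam * u 0| ≤ ‖E4.spatial u‖ + |u 0| := by
    have h1 : |(cst - 1) * ⟪n, E4.spatial u⟫_ℝ| ≤ ‖E4.spatial u‖ := by
      rw [abs_mul]
      have : |cst - 1| ≤ 1 := by rw [abs_le]; constructor <;> linarith
      nlinarith [abs_nonneg (cst - 1), abs_nonneg ⟪n, E4.spatial u⟫_ℝ]
    have h2 : |lam * u 0| ≤ |u 0| := by
      rw [abs_mul, abs_of_nonneg hl0]; nlinarith [abs_nonneg (u 0)]
    exact (abs_sub _ _).trans (by linarith)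
  have hsp : ‖E4.spatial y‖ ≤ 2 * ‖E4.spatial u‖ + |u 0| := by
    rw [hysp]
    refine (norm_add_le _ _).trans ?_
    rw [norm_smul, hn, mul_one, Real.norm_eq_abs]
    linarith
  -- `‖y‖² = (u⁰)² + ‖y⃗‖² ≤ a² + (2b + a)² ≤ 9(a² + b²) = 9‖u‖²`, `a = |u⁰|`, `b = ‖u⃗‖`
  have h9 : ‖y‖ ^ 2 ≤ (3 * ‖u‖) ^ 2 := by
    rw [hysq, hy0]
    have hs0 : 0 ≤ ‖E4.spatial y‖ := norm_nonneg _
    have ha0 : 0 ≤ |u 0| := abs_nonneg _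
    have hb0 : 0 ≤ ‖E4.spatial u‖ := norm_nonneg _
    have h2 : ‖E4.spatial y‖ ^ 2 ≤ (2 * ‖E4.spatial u‖ + |u 0|) ^ 2 := by nlinarith
    nlinarith [sq_abs (u 0), sq_nonneg (|u 0| - ‖E4.spatial u‖)]
  exact (pow_le_pow_iff_left₀ (norm_nonneg y) (by positivity) two_ne_zero).mp h9

/-- The polynomial identity behind `frame_pullback` (coefficients of `αβ`, `a₀β`, `αb₀`, `a₀b₀`). [folklore] -/
theorem frame_pullback_poly (S μ κ cst lam α β a₀ b₀ uw : ℝ) (hc2 : cst ^ 2 * (1 + κ) = 1)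
    (hlam : lam * (1 + κ) = μ) (hμ : μ ^ 2 + (1 - S) * κ = S) (hκ : 0 ≤ κ) :
    (-(a₀ * b₀) + (uw + ((cst - 1) * β - lam * b₀) * α + ((cst - 1) * α - lam * a₀) * β +
        ((cst - 1) * α - lam * a₀) * ((cst - 1) * β - lam * b₀))) + S * (a₀ * b₀) +
      μ * (a₀ * (β + ((cst - 1) * β - lam * b₀)) + (α + ((cst - 1) * α - lam * a₀)) * b₀) +
      κ * ((α + ((cst - 1) * α - lam * a₀)) * (β + ((cst - 1) * β - lam * b₀))) =
    (-(a₀ * b₀) + uw) + κ / (1 + κ) * (a₀ * b₀) := by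
  have h1 : (1 + κ) ≠ 0 := by positivity
  field_simp
  linear_combination (α * β * (1 + κ)) * hc2 - (a₀ * cst * β * (1 + κ)) * hlam - (b₀ * cst * α * (1 + κ)) * hlam +
    (a₀ * b₀ * (lam * (1 + κ) - μ)) * hlam - (a₀ * b₀) * hμ

/-- **The pull-back identity.** For `‖n‖ = 1` and parameters tied by `c²(1+κ) = 1`, `λ(1+κ) = μ`,
`μ² + (1 − S)κ = S` (`κ ≥ 0`), the frame `A` pulls the radial form `η + S dt*² + μ(dt*⊗ν + ν⊗dt*) + κ ν⊗ν`,
`ν = ⟪n, ·⃗⟫`, back to `η + (κ/(1+κ)) dt*²`: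
`R(A u, A w) = η(u, w) + (κ/(1+κ)) u⁰ w⁰` — the spatial legs become orthonormal and orthogonal to the time leg, whose
length² is `−1/(1+κ) = −α²` (`α` the lapse). [cite: MartelPoisson2001, §II] -/
theorem frame_pullback (hn : ‖n‖ = 1) {S μ κ : ℝ} (hκ : 0 ≤ κ) (hc2 : cst ^ 2 * (1 + κ) = 1)
    (hlam : lam * (1 + κ) = μ) (hμ : μ ^ 2 + (1 - S) * κ = S) (u w : E4) :
    Minkowski.bilin
        ((u 0) • (E4.basisVector 0 : E4) +
          E4.ofTimeSpace 0 (E4.spatial u + ((cst - 1) * ⟪n, E4.spatial u⟫_ℝ - lam * u 0) • n))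
        ((w 0) • (E4.basisVector 0 : E4) +
          E4.ofTimeSpace 0 (E4.spatial w + ((cst - 1) * ⟪n, E4.spatial w⟫_ℝ - lam * w 0) • n)) +
      S * (u 0 * w 0) +
      μ * (u 0 * ⟪n, E4.spatial w + ((cst - 1) * ⟪n, E4.spatial w⟫_ℝ - lam * w 0) • n⟫_ℝ +
        ⟪n, E4.spatial u + ((cst - 1) * ⟪n, E4.spatial u⟫_ℝ - lam * u 0) • n⟫_ℝ * w 0) +
      κ * (⟪n, E4.spatial u + ((cst - 1) * ⟪n, E4.spatial u⟫_ℝ - lam * u 0) • n⟫_ℝ *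
        ⟪n, E4.spatial w + ((cst - 1) * ⟪n, E4.spatial w⟫_ℝ - lam * w 0) • n⟫_ℝ) =
    Minkowski.bilin u w + κ / (1 + κ) * (u 0 * w 0) := by
  have hnn : ⟪n, n⟫_ℝ = 1 := by rw [real_inner_self_eq_norm_sq, hn, one_pow]
  obtain ⟨hu0, husp⟩ := frame_components n cst lam u
  obtain ⟨hw0, hwsp⟩ := frame_components n cst lam w
  rw [Kerr.minkowski_bilin_eq_spatial, Kerr.minkowski_bilin_eq_spatial, hu0, hw0, husp, hwsp]
  simp only [inner_add_left, inner_add_right, inner_smul_left, inner_smul_right, hnn, mul_one, RCLike.conj_to_real,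
    real_inner_comm n (E4.spatial u)]
  have key := frame_pullback_poly S μ κ cst lam ⟪n, E4.spatial u⟫_ℝ ⟪n, E4.spatial w⟫_ℝ (u 0) (w 0)
    ⟪E4.spatial u, E4.spatial w⟫_ℝ hc2 hlam hμ hκ
  rw [real_inner_comm (E4.spatial w) (E4.spatial u)] at key ⊢
  linear_combination key

end Frame

/-! ### The parameters at a radial clock rate -/

/-- **Relations between the clock rate and the frame parameters.** For `S = s² ∈ [0, 1)` (`S = 2M/r` outside the
horizon) and a rate `0 ≤ p ≤ s/(1 + s)` (between the Kerr–Schild clock `p = 0` and the Painlevé–Gullstrand one),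
`μ = S + p(1 − S)` and `κ = S(1 − p)² − p²` satisfy `0 ≤ κ ≤ S`, `0 ≤ μ ≤ 1`, `μ² + (1 − S)κ = S`; and `κ = 0` exactly
at the Painlevé–Gullstrand rate `p = s/(1 + s)` (flat slices). [cite: MartelPoisson2001, §II] -/
theorem clockRate_relations {S p : ℝ} (hS0 : 0 ≤ S) (hS1 : S < 1) (hp0 : 0 ≤ p) (hp1 : p ≤ √S / (1 + √S)) :
    0 ≤ S * (1 - p) ^ 2 - p ^ 2 ∧ S * (1 - p) ^ 2 - p ^ 2 ≤ S ∧ 0 ≤ S + p * (1 - S) ∧ S + p * (1 - S) ≤ 1 ∧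
      (S + p * (1 - S)) ^ 2 + (1 - S) * (S * (1 - p) ^ 2 - p ^ 2) = S ∧
      (p = √S / (1 + √S) → S * (1 - p) ^ 2 - p ^ 2 = 0) := by
  have hs0 : 0 ≤ √S := Real.sqrt_nonneg S
  have hsS : √S ^ 2 = S := Real.sq_sqrt hS0
  have hp1' : p * (1 + √S) ≤ √S := by rwa [le_div_iff₀ (by positivity)] at hp1
  have hplt : p < 1 := by
    have : √S / (1 + √S) < 1 := by rw [div_lt_one (by positivity)]; linarith
    exact hp1.trans_lt this
  -- `p ≤ √S (1 − p)`, both sides nonnegative, so `p² ≤ S (1 − p)²`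
  have hle : p ≤ √S * (1 - p) := by nlinarith
  have hsq : p ^ 2 ≤ S * (1 - p) ^ 2 := by
    have := mul_self_le_mul_self hp0 hle
    nlinarith [hsS]
  refine ⟨by linarith, ?_, by nlinarith, by nlinarith, by ring, fun hp ↦ ?_⟩
  · nlinarith
  · subst hp
    have h1 : (1 + √S) ≠ 0 := by positivity
    field_simp
    nlinarith [hsS]



/-- Registered summary (stmt-FinalStateConjecture-17430, route seat 1): the frame parameters at a radial clock rate
between Kerr–Schild and Painlevé–Gullstrand (`0 ≤ κ ≤ S`, `0 ≤ μ ≤ 1`, `μ² + (1−S)κ = S`, `κ = 0` at the PG rate).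
[cite: MartelPoisson2001, §II] -/
theorem schwarzschild_clockRate_relations : ∀ {S p : ℝ}, 0 ≤ S → S < 1 → 0 ≤ p → p ≤ √S / (1 + √S) → 0 ≤ S * (1 - p) ^ 2 - p ^ 2 ∧ S * (1 - p) ^ 2 - p ^ 2 ≤ S ∧ 0 ≤ S + p * (1 - S) ∧ S + p * (1 - S) ≤ 1 ∧ (S + p * (1 - S)) ^ 2 + (1 - S) * (S * (1 - p) ^ 2 - p ^ 2) = S ∧ (p = √S / (1 + √S) → S * (1 - p) ^ 2 - p ^ 2 = 0) :=
  fun hS0 hS1 hp0 hp1 ↦ clockRate_relations hS0 hS1 hp0 hp1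

end Summit.FinalStateConjecture.FinalStateConjecture.Theorems.TameHull.Schw

end
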